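import Summits.CriticalPhenomena.PercolationContinuityZ3.Theorems.PercNearOneGluingAdditiveGluingKnThm2RefinedAux
import Summits.CriticalPhenomena.PercolationContinuityZ3.Theorems.PercNearOneGluingAdditiveGluingBhkSets
import Summits.CriticalPhenomena.PercolationContinuityZ3.Theorems.PercNearOneGluingAdditiveGluingThreeRelaysKPatterns
import HarnessLib

/-!
# Crux `PercNearOneGluing.AdditiveGluing` (stmt-CriticalPhenomena-4576): POOLING SUPPRESSES BADNESS — the first step of the
# (K)-route to the three-relay case (seat (d) exchange-certificate form, gen 3)

Support file (`--supports stmt-CriticalPhenomena-4576`); no definitions, no named facts, no sorries.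

Three relays `a₁, a₂, a₃`, target `b`; `N₁₂ = {a₁ ↮ a₃} ∩ {a₂ ↮ a₃}` (the pair is separated from `a₃`), `M = N₁₂ ∩ {a₁ ↮ a₂}`
(all relays separated), `R₁₂ = N₁₂ ∩ {a₁ ↔ a₂}` (the pair is "pooled"), `m_T = μ(C(b) ∩ A = T)`, `Δ = m₃ − m₁₂` (badness).
* `pooling_single_le` (**pooling vs. singles**): `μ(R₁₂) · μ(M ∩ b↔a₁) ≤ μ(M) · m₁₂` — van den Berg–Häggström–Kahn's positive
  correlation of the increasing events `{a₁ ↔ a₂}` and `{a₁ ↔ b}` of the cluster of `{a₁,a₂}` given `N₁₂` (`knRef_bhkOne` with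
  `O = {a₁}`, observer `a₂`), rearranged: the odds of pooling are higher on `{b ↔ a₁}`.
* `pooling_badness_le` (**pooling suppresses badness**): if `a₃` is a worst relay (`τ₃ ≤ τ₁`) then
  `μ(R₁₂) · Δ ≤ μ(M) · m₁₂ + μ(R₁₂) · [μ(R₂₃ ∩ b↔a₁) − m₂₃]`  (`R₂₃ = {a₁ ↮ a₂} ∩ {a₁ ↮ a₃} ∩ {a₂ ↔ a₃}`), because
  `Δ ≤ m₁ − m₂₃` (Kozma–Nitzan eq. (7), `kred_tau_sub₁`) and `m₁ = μ(M ∩ b↔a₁) + μ(R₂₃ ∩ b↔a₁)`.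
These are the o-free steps behind this seat's numerical findings (evidence EXCHCERT-g3.md): `μ(R₁₂)·Δ ≤ μ(M ∩ a₃↮b)` (0 violations,
×20 margin) and the (K)-inequality `(φ₁₂ − φ₁ − φ₂)·Δ ≤ μ(o ↮ A, a₃ ↮ b)` (0 violations, ×9 margin) which closes the three-relay case
(`…ThreeRelaysKReduction`): when `o` pools `a₁, a₂` strongly (`μ(M) ≪ μ(R₁₂)`) the badness `Δ` is at most `(μ(M)/μ(R₁₂))·m₁₂` plus
the `R₂₃`-drift term.  [cite: VandenbergHaggstromKahn2005, Thm. 1.3 (p. 6); KozmaNitzan2024, Lemma 1 (p. 5), Theorem 2 eq. (7) (p. 8)]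
-/

namespace Summit.CriticalPhenomena.PercolationContinuityZ3.Theorems

open MeasureTheory Set Literature.Probability.LatticeModels Literature.Probability.Percolation

noncomputable section
open Classical

variable {n : ℕ}

/-- **Pooling vs. singles**: `μ(R₁₂) · μ(M ∩ b↔a₁) ≤ μ(M) · m₁₂`, i.e.
`μ(N₁₂ ∩ a₁↔a₂) · μ(N₁₂ ∩ (a₁↔a₂)ᶜ ∩ a₁↔b) ≤ μ(N₁₂ ∩ (a₁↔a₂)ᶜ) · μ(N₁₂ ∩ (a₁↔a₂ ∩ a₁↔b))` with `N₁₂ = (a₁↔a₃)ᶜ ∩ (a₂↔a₃)ᶜ`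
(BHK 2006 Thm 1.3 for the cluster of `{a₁,a₂}` given `{a₁,a₂} ↮ a₃`). [cite: VandenbergHaggstromKahn2005, Thm. 1.3 (p. 6)] -/
theorem pooling_single_le (w : Sym2 (Fin n) → unitInterval) (b a₁ a₂ a₃ : Fin n) (h13 : a₁ ≠ a₃) (h23 : a₂ ≠ a₃) :
    (prodBernoulli w).real ((openConn a₁ a₃)ᶜ ∩ (openConn a₂ a₃)ᶜ ∩ openConn a₁ a₂) *
        (prodBernoulli w).real ((openConn a₁ a₃)ᶜ ∩ (openConn a₂ a₃)ᶜ ∩ (openConn a₁ a₂)ᶜ ∩ openConn a₁ b) ≤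
      (prodBernoulli w).real ((openConn a₁ a₃)ᶜ ∩ (openConn a₂ a₃)ᶜ ∩ (openConn a₁ a₂)ᶜ) *
        (prodBernoulli w).real ((openConn a₁ a₃)ᶜ ∩ (openConn a₂ a₃)ᶜ ∩ (openConn a₁ a₂ ∩ openConn a₁ b)) := by
  have hm : ∀ s : Set (BondConfig (Fin n)), MeasurableSet s := fun _ => MeasurableSet.of_discrete
  have hs : ({a₁} : Finset (Fin n)) ⊆ {a₁, a₂} := by
    intro x hx; simp only [Finset.mem_insert, Finset.mem_singleton] at hx ⊢; tauto
  have key := knRef_bhkOne stub_bhkSets.1 w {a₁, a₂} {a₁} hs ({a₃} : Set (Fin n)) a₂ b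
    (by simp [h13, h23])
  rw [knThm2_sep_pair_set, Finset.set_biUnion_singleton, Finset.set_biInter_singleton] at key
  -- split `μ(N ∩ a₁b)` and `μ(N)` along `{a₁ ↔ a₂}`
  set N : Set (BondConfig (Fin n)) := (openConn a₁ a₃)ᶜ ∩ (openConn a₂ a₃)ᶜ with hN
  have h1 := measureReal_inter_add_sdiff (μ := prodBernoulli w) (s := N ∩ openConn a₁ b) (hm (openConn a₁ a₂))
  have h2 := measureReal_inter_add_sdiff (μ := prodBernoulli w) (s := N) (hm (openConn a₁ a₂))
  have e1 : N ∩ openConn a₁ b ∩ openConn a₁ a₂ = N ∩ (openConn a₁ a₂ ∩ openConn a₁ b) := by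
    ext ω; simp only [Set.mem_inter_iff]; tauto
  have e2 : (N ∩ openConn a₁ b) \ openConn a₁ a₂ = N ∩ (openConn a₁ a₂)ᶜ ∩ openConn a₁ b := by
    ext ω; simp only [Set.mem_inter_iff, Set.mem_sdiff, Set.mem_compl_iff]; tauto
  have e3 : N \ openConn a₁ a₂ = N ∩ (openConn a₁ a₂)ᶜ := by
    ext ω; simp only [Set.mem_inter_iff, Set.mem_sdiff, Set.mem_compl_iff]
  rw [e1, e2] at h1
  rw [e3] at h2
  have hF : 0 ≤ (prodBernoulli w).real (N ∩ openConn a₁ a₂) := measureReal_nonneg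
  have hL : 0 ≤ (prodBernoulli w).real (N ∩ (openConn a₁ a₂ ∩ openConn a₁ b)) := measureReal_nonneg
  nlinarith [key, h1, h2, hF, hL]

/-- **Pooling suppresses badness**: for a worst relay `a₃` (`τ₃ ≤ τ₁`),
`μ(R₁₂) · (m₃ − m₁₂) ≤ μ(M) · m₁₂ + μ(R₁₂) · (μ(R₂₃ ∩ b↔a₁) − m₂₃)` in the event forms of `knThm2_region_eform`
(`m₁₂ = μ(N₁₂ ∩ (a₁↔b ∩ a₂↔b))`, `m₃ = μ(N₁₂ ∩ a₃↔b)`, `m₂₃ = μ(N₁ ∩ (a₂↔b ∩ a₃↔b))`, `R₂₃ = N₁ ∩ a₂↔a₃`,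
`N₁ = (a₁↔a₂)ᶜ ∩ (a₁↔a₃)ᶜ`). [cite: KozmaNitzan2024, Theorem 2 eq. (7) (p. 8); VandenbergHaggstromKahn2005, Thm. 1.3] -/
theorem pooling_badness_le (w : Sym2 (Fin n) → unitInterval) (b a₁ a₂ a₃ : Fin n) (h13 : a₁ ≠ a₃) (h23 : a₂ ≠ a₃)
    (hτ31 : (prodBernoulli w).real (openConn a₃ b) ≤ (prodBernoulli w).real (openConn a₁ b)) :
    (prodBernoulli w).real ((openConn a₁ a₃)ᶜ ∩ (openConn a₂ a₃)ᶜ ∩ openConn a₁ a₂) *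
        ((prodBernoulli w).real ((openConn a₁ a₃)ᶜ ∩ (openConn a₂ a₃)ᶜ ∩ openConn a₃ b) -
          (prodBernoulli w).real ((openConn a₁ a₃)ᶜ ∩ (openConn a₂ a₃)ᶜ ∩ (openConn a₁ b ∩ openConn a₂ b))) ≤
      (prodBernoulli w).real ((openConn a₁ a₃)ᶜ ∩ (openConn a₂ a₃)ᶜ ∩ (openConn a₁ a₂)ᶜ) *
          (prodBernoulli w).real ((openConn a₁ a₃)ᶜ ∩ (openConn a₂ a₃)ᶜ ∩ (openConn a₁ b ∩ openConn a₂ b)) +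
        (prodBernoulli w).real ((openConn a₁ a₃)ᶜ ∩ (openConn a₂ a₃)ᶜ ∩ openConn a₁ a₂) *
          ((prodBernoulli w).real ((openConn a₁ a₂)ᶜ ∩ (openConn a₁ a₃)ᶜ ∩ openConn a₂ a₃ ∩ openConn a₁ b) -
            (prodBernoulli w).real ((openConn a₁ a₂)ᶜ ∩ (openConn a₁ a₃)ᶜ ∩ (openConn a₂ b ∩ openConn a₃ b))) := by
  have hm : ∀ s : Set (BondConfig (Fin n)), MeasurableSet s := fun _ => MeasurableSet.of_discrete
  have hP := pooling_single_le w b a₁ a₂ a₃ h13 h23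
  have hτ := kred_tau_sub₁ w b a₁ a₂ a₃
  -- `m₁ = μ(M ∩ a₁b) + μ(R₂₃ ∩ a₁b)`
  have h1 := measureReal_inter_add_sdiff (μ := prodBernoulli w)
    (s := (openConn a₁ a₂)ᶜ ∩ (openConn a₁ a₃)ᶜ ∩ openConn a₁ b) (hm (openConn a₂ a₃))
  have e1 : ((openConn a₁ a₂)ᶜ ∩ (openConn a₁ a₃)ᶜ ∩ openConn a₁ b ∩ openConn a₂ a₃ : Set (BondConfig (Fin n))) =
      (openConn a₁ a₂)ᶜ ∩ (openConn a₁ a₃)ᶜ ∩ openConn a₂ a₃ ∩ openConn a₁ b := by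
    ext ω; simp only [Set.mem_inter_iff]; tauto
  have e2 : (((openConn a₁ a₂)ᶜ ∩ (openConn a₁ a₃)ᶜ ∩ openConn a₁ b) \ openConn a₂ a₃ : Set (BondConfig (Fin n))) =
      (openConn a₁ a₃)ᶜ ∩ (openConn a₂ a₃)ᶜ ∩ (openConn a₁ a₂)ᶜ ∩ openConn a₁ b := by
    ext ω; simp only [Set.mem_inter_iff, Set.mem_sdiff, Set.mem_compl_iff]; tauto
  rw [e1, e2] at h1
  have hR : 0 ≤ (prodBernoulli w).real ((openConn a₁ a₃)ᶜ ∩ (openConn a₂ a₃)ᶜ ∩ openConn a₁ a₂) := measureReal_nonneg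
  -- `Δ ≤ m₁ − m₂₃ = μ(M ∩ a₁b) + μ(R₂₃ ∩ a₁b) − m₂₃` (a₃ worst), multiplied by `μ(R₁₂) ≥ 0`
  have hΔ : (prodBernoulli w).real ((openConn a₁ a₃)ᶜ ∩ (openConn a₂ a₃)ᶜ ∩ openConn a₃ b) -
        (prodBernoulli w).real ((openConn a₁ a₃)ᶜ ∩ (openConn a₂ a₃)ᶜ ∩ (openConn a₁ b ∩ openConn a₂ b)) ≤
      (prodBernoulli w).real ((openConn a₁ a₃)ᶜ ∩ (openConn a₂ a₃)ᶜ ∩ (openConn a₁ a₂)ᶜ ∩ openConn a₁ b) +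
        ((prodBernoulli w).real ((openConn a₁ a₂)ᶜ ∩ (openConn a₁ a₃)ᶜ ∩ openConn a₂ a₃ ∩ openConn a₁ b) -
          (prodBernoulli w).real ((openConn a₁ a₂)ᶜ ∩ (openConn a₁ a₃)ᶜ ∩ (openConn a₂ b ∩ openConn a₃ b))) := by
    linarith
  have key := mul_le_mul_of_nonneg_left hΔ hR
  have e3 : ((openConn a₁ a₃)ᶜ ∩ (openConn a₂ a₃)ᶜ ∩ (openConn a₁ a₂ ∩ openConn a₁ b) : Set (BondConfig (Fin n))) =
      (openConn a₁ a₃)ᶜ ∩ (openConn a₂ a₃)ᶜ ∩ (openConn a₁ b ∩ openConn a₂ b) := by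
    ext ω
    simp only [Set.mem_inter_iff, Set.mem_compl_iff, knThm2_mem_openConn]
    constructor
    · rintro ⟨hN, h12, h1b⟩
      exact ⟨hN, h1b, h12.symm.trans h1b⟩
    · rintro ⟨hN, h1b, h2b⟩
      exact ⟨hN, h1b.trans h2b.symm, h1b⟩
  rw [e3] at hP
  rw [mul_add] at key
  linarith [hP, key]

end

end Summit.CriticalPhenomena.PercolationContinuityZ3.Theorems
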